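import Mathlib
import Summits.QuantumAdvantage.QuantumAdvantage.Theorems.WalkNoPerfectKForm
import Summits.QuantumAdvantage.QuantumAdvantage.Theses.CharDial

set_option linter.dupNamespace false

/-!
# PerfectDial — exact-axis laws of the u-walk game at p ≥ 5 (cell decomp-qadv, lens 4, g13; node `PerfectDial`)

Prop-definition-free theorems over the tree's `HasDegF` / `ringWinU` (supports of item stmt-QuantumAdvantage-26994 on its
ZERO-LOSS axis):

* `kform_of_jlin` — a cut of the shape «junta `J` (`|J| ≤ L`) ⊕ ONE linear form» (the per-cut hypothesis of
  `CharDial.WalkHardFJLinOdd`, item 32604, and the conclusion of `CharDial.FrobStructureLaw`, item 32603) is an `(L+1)`-form cut;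
* `noPerfect_of_jlin` — for every prime `p ≥ 5` and every constant junta bound `L`, no JLin strategy is perfect for large `n`
  (from `Coset21.noPerfectKFormOdd`);
* `noPerfectKForm_of_count`, `count_eventually_pow`, `count_log` — the k-form no-perfect theorem with an `n`-dependent number of
  forms, and the counting inequality for `k = log₂ n + 1`;
* `noPerfect_jlin_log` — **the EXACT shadow of item 32604**: for every prime `p ≥ 5`, for large `n`, no strategy whose cuts are
  juntas of size `≤ log₂ n` ⊕ one linear form wins the u-walk game on every input (32604 itself, the θ < 1 version, is open);
* `noPerfect_of_frobStructureLaw` — **the exact Frobenius notch from the structure law alone**: `CharDial.FrobStructureLaw` (32603)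
  implies that for every prime `p ≥ 5`, for large `n`, no strategy with cuts of `𝔽_p`-degree `≤ p − 1` is perfect.

0 sorry; axioms standard; no `instance`, no `notation`, no `native_decide`.
-/

open Finset
open Summit.QuantumAdvantage.AdviceFreeQNC0

namespace Summit.QuantumAdvantage.QuantumAdvantage.Theorems.PerfectDial

section JLinEncode

variable {p : ℕ} [Fact p.Prime] {n : ℕ}

/-- the `L+1` linear forms encoding a junta `J` (`|J| ≤ L`, as coordinate forms) and one extra form `a`. -/
def encLam (L : ℕ) (J : Finset (Fin n)) (a : Fin n → ZMod p) (j : Fin (L + 1)) (i : Fin n) : ZMod p :=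
  if hj : j.val < J.card then (if ((J.orderIsoOfFin rfl ⟨j.val, hj⟩ : J) : Fin n) = i then 1 else 0)
  else if j.val = L then a i else 0

/-- index of a junta coordinate among the first `J.card` forms. -/
def encIdx (L : ℕ) (J : Finset (Fin n)) (hJ : J.card ≤ L) (i : Fin n) (hi : i ∈ J) : Fin (L + 1) :=
  ⟨((J.orderIsoOfFin rfl).symm ⟨i, hi⟩).val,
    lt_of_lt_of_le ((J.orderIsoOfFin rfl).symm ⟨i, hi⟩).isLt (Nat.le_succ_of_le hJ)⟩

/-- the table reading a JLin cut off its `L+1` encoded forms. -/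
def encF (L : ℕ) (J : Finset (Fin n)) (hJ : J.card ≤ L) (h : (Fin n → Bool) → ZMod p → Bool)
    (s : Fin (L + 1) → ZMod p) : Bool :=
  h (fun i => if hi : i ∈ J then decide (s (encIdx L J hJ i hi) = 1) else false) (s ⟨L, Nat.lt_succ_self L⟩)

/-- the junta forms read the junta bits. -/
theorem encForm_junta (L : ℕ) (J : Finset (Fin n)) (hJ : J.card ≤ L) (a : Fin n → ZMod p) (u : Fin n → Bool)
    (i : Fin n) (hi : i ∈ J) :
    (∑ i', if u i' = true then encLam (p := p) L J a (encIdx L J hJ i hi) i' else 0) = if u i = true then 1 else 0 := by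
  classical
  have hlt : ((J.orderIsoOfFin rfl).symm ⟨i, hi⟩).val < J.card := ((J.orderIsoOfFin rfl).symm ⟨i, hi⟩).isLt
  have hback : ((J.orderIsoOfFin rfl ⟨((J.orderIsoOfFin rfl).symm ⟨i, hi⟩).val, hlt⟩ : J) : Fin n) = i := by
    have : (⟨((J.orderIsoOfFin rfl).symm ⟨i, hi⟩).val, hlt⟩ : Fin J.card) = (J.orderIsoOfFin rfl).symm ⟨i, hi⟩ :=
      Fin.ext rfl
    rw [this, OrderIso.apply_symm_apply]
  have hsummand : ∀ i' : Fin n, (if u i' = true then encLam (p := p) L J a (encIdx L J hJ i hi) i' else 0)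
      = if i = i' then (if u i' = true then (1 : ZMod p) else 0) else 0 := by
    intro i'
    unfold encLam encIdx
    simp only [hlt, dif_pos, hback]
    by_cases hii : i = i'
    · simp [hii]
    · simp [hii]
  rw [Finset.sum_congr rfl fun i' _ => hsummand i', Finset.sum_ite_eq]
  simp

/-- the last form is the extra linear form. -/
theorem encForm_last (L : ℕ) (J : Finset (Fin n)) (hJ : J.card ≤ L) (a : Fin n → ZMod p) (u : Fin n → Bool) :
    (∑ i', if u i' = true then encLam (p := p) L J a ⟨L, Nat.lt_succ_self L⟩ i' else 0)
      = ∑ i', if u i' then a i' else 0 := by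
  refine Finset.sum_congr rfl fun i' _ => ?_
  have hnot : ¬ ((⟨L, Nat.lt_succ_self L⟩ : Fin (L + 1)).val < J.card) := by simp; omega
  unfold encLam
  rw [dif_neg hnot]
  simp

/-- **JLin cuts are `(L+1)`-form cuts**: a strategy whose every cut is a junta of size `≤ L` ⊕ one linear form is an
`(L+1)`-form strategy in the sense of `Coset21.noPerfectKFormOdd`. -/
theorem kform_of_jlin {L : ℕ} (y : Fin (n + 1) → (Fin n → Bool) → Bool)
    (hy : ∀ g, ∃ J : Finset (Fin n), J.card ≤ L ∧ ∃ a : Fin n → ZMod p, ∃ h : (Fin n → Bool) → ZMod p → Bool,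
      (∀ u v : Fin n → Bool, (∀ i ∈ J, u i = v i) → ∀ s, h u s = h v s) ∧ ∀ u, y g u = h u (∑ i, if u i then a i else 0)) :
    ∃ lam : Fin (n + 1) → Fin (L + 1) → Fin n → ZMod p, ∃ F : Fin (n + 1) → (Fin (L + 1) → ZMod p) → Bool,
      ∀ g u, y g u = F g (fun j => ∑ i, if u i = true then lam g j i else 0) := by
  classical
  choose J hJ a h hjun hrep using hy
  refine ⟨fun g => encLam L (J g) (a g), fun g => encF L (J g) (hJ g) (h g), fun g u => ?_⟩
  have goal : h g u (∑ i, if u i = true then a g i else 0)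
      = h g (fun i => if hi : i ∈ J g then
            decide ((∑ i', if u i' = true then encLam L (J g) (a g) (encIdx L (J g) (hJ g) i hi) i' else 0) = 1)
          else false)
          (∑ i', if u i' = true then encLam L (J g) (a g) ⟨L, Nat.lt_succ_self L⟩ i' else 0) := by
    rw [encForm_last L (J g) (hJ g) (a g) u]
    refine hjun g u _ (fun i hi => ?_) _
    rw [dif_pos hi, encForm_junta L (J g) (hJ g) (a g) u i hi]
    cases u i <;> simp
  rw [hrep g u]
  exact goal

end JLinEncode

/-- **No JLin strategy with a CONSTANT junta bound is perfect** (every prime `p ≥ 5`, every `L`, all large `n`). -/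
theorem noPerfect_of_jlin (p : ℕ) [Fact p.Prime] (hp : 5 ≤ p) (L : ℕ) :
    ∃ n₀ : ℕ, ∀ n ≥ n₀, ∀ c : ℕ, ∀ y : Fin (n + 1) → (Fin n → Bool) → Bool,
      (∀ g, ∃ J : Finset (Fin n), J.card ≤ L ∧ ∃ a : Fin n → ZMod p, ∃ h : (Fin n → Bool) → ZMod p → Bool,
        (∀ u v : Fin n → Bool, (∀ i ∈ J, u i = v i) → ∀ s, h u s = h v s) ∧
          ∀ u, y g u = h u (∑ i, if u i then a i else 0)) →
      ∃ u, ringWinU c y u = false := by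
  obtain ⟨n₀, hn₀⟩ := Coset21.noPerfectKFormOdd p hp (L + 1)
  refine ⟨n₀, fun n hn c y hy => ?_⟩
  obtain ⟨lam, F, hF⟩ := kform_of_jlin y hy
  exact hn₀ n hn c lam F y hF

/-- the numerical threshold with a polynomial factor: `(n+1)·n^a·A·(q−1)ⁿ < qⁿ` for all large `n` (`q ≥ 2`). -/
theorem count_eventually_pow (A a q : ℕ) (hq : 2 ≤ q) :
    ∃ n₀, ∀ n ≥ n₀, (n + 1) * n ^ a * A * (q - 1) ^ n < q ^ n := by
  have hq0 : (0 : ℝ) < q := by exact_mod_cast (by omega : 0 < q)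
  set ρ : ℝ := ((q : ℝ) - 1) / q with hρ
  have hq2 : (2 : ℝ) ≤ q := by exact_mod_cast hq
  have hρ0 : 0 ≤ ρ := div_nonneg (by linarith) hq0.le
  have hρ1 : ρ < 1 := by rw [div_lt_one hq0]; linarith
  have habs : |ρ| < 1 := by rw [abs_of_nonneg hρ0]; exact hρ1
  have ht := tendsto_pow_const_mul_const_pow_of_abs_lt_one (a + 1) habs
  have hε : (0 : ℝ) < 1 / (2 * A + 2) := by positivity
  obtain ⟨N, hN⟩ := Filter.eventually_atTop.mp (ht.eventually (gt_mem_nhds hε))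
  refine ⟨max N 1, fun n hn => ?_⟩
  have hnN : N ≤ n := le_trans (le_max_left _ _) hn
  have hn1 : (1 : ℝ) ≤ n := by exact_mod_cast le_trans (le_max_right _ _) hn
  have h1 : (n : ℝ) ^ (a + 1) * ρ ^ n < 1 / (2 * A + 2) := hN n hnN
  have hqn : (0 : ℝ) < (q : ℝ) ^ n := pow_pos hq0 n
  have hsmall : ((n : ℝ) + 1) * (n : ℝ) ^ a * A * ρ ^ n < 1 := by
    have h0 : (0 : ℝ) ≤ (n : ℝ) ^ a * A * ρ ^ n := by positivity
    calc ((n : ℝ) + 1) * (n : ℝ) ^ a * A * ρ ^ n = ((n : ℝ) + 1) * ((n : ℝ) ^ a * A * ρ ^ n) := by ring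
      _ ≤ 2 * n * ((n : ℝ) ^ a * A * ρ ^ n) := by nlinarith
      _ = 2 * A * ((n : ℝ) ^ (a + 1) * ρ ^ n) := by ring
      _ ≤ 2 * A * (1 / (2 * A + 2)) := by apply mul_le_mul_of_nonneg_left h1.le; positivity
      _ < 1 := by rw [mul_one_div, div_lt_one (by positivity)]; linarith
  have key : ((n : ℝ) + 1) * (n : ℝ) ^ a * A * ((q : ℝ) - 1) ^ n < (q : ℝ) ^ n := by
    have hρn : ((q : ℝ) - 1) ^ n = ρ ^ n * (q : ℝ) ^ n := by
      rw [hρ, div_pow, div_mul_cancel₀ _ hqn.ne']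
    rw [hρn]
    calc ((n : ℝ) + 1) * (n : ℝ) ^ a * A * (ρ ^ n * (q : ℝ) ^ n)
        = (((n : ℝ) + 1) * (n : ℝ) ^ a * A * ρ ^ n) * (q : ℝ) ^ n := by ring
      _ < 1 * (q : ℝ) ^ n := mul_lt_mul_of_pos_right hsmall hqn
      _ = (q : ℝ) ^ n := one_mul _
  have hcast : (((n + 1) * n ^ a * A * (q - 1) ^ n : ℕ) : ℝ)
      = ((n : ℝ) + 1) * (n : ℝ) ^ a * A * ((q : ℝ) - 1) ^ n := by
    push_cast [Nat.cast_sub (by omega : 1 ≤ q)]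
    ring
  have : (((n + 1) * n ^ a * A * (q - 1) ^ n : ℕ) : ℝ) < ((q ^ n : ℕ) : ℝ) := by
    rw [hcast]; push_cast; exact key
  exact_mod_cast this

/-- the `k`-form no-perfect theorem with an ARBITRARY (`n`-dependent) number of forms, given the counting inequality
(`Coset21.CharTwoKill.abstract_even_existsK` instantiated exactly as in `Coset21.noPerfectKForm`). -/
theorem noPerfectKForm_of_count {p : ℕ} [Fact p.Prime] (hp5 : 5 ≤ p) {n k : ℕ}
    (hcount : (n + 1) * (p ^ k * 2) * (2 * p - 1) ^ n < (2 * p) ^ n) (c : ℕ)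
    (lam : Fin (n + 1) → Fin k → Fin n → ZMod p) (F : Fin (n + 1) → (Fin k → ZMod p) → Bool)
    (y : Fin (n + 1) → (Fin n → Bool) → Bool)
    (hy : ∀ g u, y g u = F g (fun j => ∑ i, if u i = true then lam g j i else 0)) :
    ∃ u, ringWinU c y u = false := by
  classical
  obtain ⟨hK, ω, ζ, hω, hζ⟩ := Coset21.exists_charTwo_roots p hp5
  have hcount' : Fintype.card (Fin (n + 1)) * (p ^ k * 2) * (2 * p - 1) ^ n < (2 * p) ^ n := by
    rw [Fintype.card_fin]; exact hcount
  obtain ⟨u, hu⟩ := Coset21.CharTwoKill.abstract_even_existsK ω ζ hω lam F (fun g : Fin (n + 1) => c + g.val)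
    (fun (g : Fin (n + 1)) (i : Fin n) => Coset21.CharTwoKill.ww g.val i) hp5 hζ
    (fun g i => Coset21.CharTwoKill.ww_mem g.val i) hcount'
  refine ⟨u, ?_⟩
  rw [Bool.eq_false_iff]
  intro hwin
  simp only [ringWinU, decide_eq_true_eq] at hwin
  rw [Coset21.CharTwoKill.walkK_filter_eq c y lam F hy u] at hwin
  omega

/-- the counting inequality for `k = log₂ n + 1` forms holds for all large `n`. -/
theorem count_log (p : ℕ) (hp : 2 ≤ p) :
    ∃ n₀, ∀ n ≥ n₀, (n + 1) * (p ^ (Nat.log 2 n + 1) * 2) * (2 * p - 1) ^ n < (2 * p) ^ n := by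
  obtain ⟨n₀, hn₀⟩ := count_eventually_pow (2 * p) p (2 * p) (by omega)
  refine ⟨max n₀ 1, fun n hn => ?_⟩
  have hn1 : n ≠ 0 := by have := le_trans (le_max_right _ _) hn; omega
  have hpl : p ^ Nat.log 2 n ≤ n ^ p := by
    calc p ^ Nat.log 2 n ≤ (2 ^ p) ^ Nat.log 2 n := Nat.pow_le_pow_left Nat.lt_two_pow_self.le _
      _ = (2 ^ Nat.log 2 n) ^ p := by rw [← pow_mul, mul_comm, pow_mul]
      _ ≤ n ^ p := Nat.pow_le_pow_left (Nat.pow_log_le_self 2 hn1) _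
  have hstep : (n + 1) * (p ^ (Nat.log 2 n + 1) * 2) * (2 * p - 1) ^ n
      ≤ (n + 1) * n ^ p * (2 * p) * (2 * p - 1) ^ n := by
    have : p ^ (Nat.log 2 n + 1) * 2 ≤ n ^ p * (2 * p) := by
      rw [pow_succ]
      calc p ^ Nat.log 2 n * p * 2 = p ^ Nat.log 2 n * (2 * p) := by ring
        _ ≤ n ^ p * (2 * p) := Nat.mul_le_mul_right _ hpl
    calc (n + 1) * (p ^ (Nat.log 2 n + 1) * 2) * (2 * p - 1) ^ n
        ≤ (n + 1) * (n ^ p * (2 * p)) * (2 * p - 1) ^ n := by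
          apply Nat.mul_le_mul_right; apply Nat.mul_le_mul_left; exact this
      _ = (n + 1) * n ^ p * (2 * p) * (2 * p - 1) ^ n := by ring
  exact lt_of_le_of_lt hstep (hn₀ n (le_trans (le_max_left _ _) hn))

/-- **THE EXACT SHADOW OF ITEM 32604 (`CharDial.WalkHardFJLinOdd`), PROVED**: for every prime `p ≥ 5`, for all large `n`,
no strategy whose cuts are juntas of size `≤ log₂ n` ⊕ ONE linear form wins the u-walk game on every input. -/
theorem noPerfect_jlin_log (p : ℕ) [Fact p.Prime] (hp : 5 ≤ p) :
    ∃ n₀ : ℕ, ∀ n ≥ n₀, ∀ c : ℕ, ∀ y : Fin (n + 1) → (Fin n → Bool) → Bool,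
      (∀ g, ∃ J : Finset (Fin n), J.card ≤ Nat.log 2 n ∧ ∃ a : Fin n → ZMod p, ∃ h : (Fin n → Bool) → ZMod p → Bool,
        (∀ u v : Fin n → Bool, (∀ i ∈ J, u i = v i) → ∀ s, h u s = h v s) ∧
          ∀ u, y g u = h u (∑ i, if u i then a i else 0)) →
      ∃ u, ringWinU c y u = false := by
  obtain ⟨n₀, hn₀⟩ := count_log p (by omega)
  refine ⟨n₀, fun n hn c y hy => ?_⟩
  obtain ⟨lam, F, hF⟩ := kform_of_jlin (L := Nat.log 2 n) y hy
  exact noPerfectKForm_of_count hp (hn₀ n hn) c lam F y hF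

/-- a win count `≤ θ·2ⁿ` with `θ < 1` leaves at least one losing input. -/
theorem exists_fail_of_card_le {n : ℕ} (c : ℕ) (y : Fin (n + 1) → (Fin n → Bool) → Bool) {θ : ℝ} (hθ : θ < 1)
    (h : ((univ.filter fun u : Fin n → Bool => ringWinU c y u = true).card : ℝ) ≤ θ * (2 : ℝ) ^ n) :
    ∃ u, ringWinU c y u = false := by
  by_contra hno
  simp only [not_exists, Bool.not_eq_false] at hno
  have hcard : (univ.filter fun u : Fin n → Bool => ringWinU c y u = true) = univ :=
    Finset.filter_true_of_mem fun u _ => hno u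
  rw [hcard, Finset.card_univ, Fintype.card_fun, Fintype.card_bool, Fintype.card_fin] at h
  push_cast at h
  have h2 : (0 : ℝ) < (2 : ℝ) ^ n := by positivity
  nlinarith

/-- **THE EXACT FROBENIUS NOTCH FROM THE STRUCTURE LAW ALONE**: `CharDial.FrobStructureLaw` (item 32603: a Boolean function of
`𝔽_p`-degree `≤ p − 1` is a junta ⊕ one linear form) implies that for every prime `p ≥ 5`, for large `n`, no strategy with cuts
of `𝔽_p`-degree `≤ p − 1` is perfect.  (The θ < 1 notch `CharDial.FrobHardOdd`, item 32598, needs 32603 AND 32604.) -/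
theorem noPerfect_of_frobStructureLaw (hS : Theses.CharDial.FrobStructureLaw) (p : ℕ) [Fact p.Prime] (hp : 5 ≤ p) :
    ∃ n₀ : ℕ, ∀ n ≥ n₀, ∀ c : ℕ, ∀ y : Fin (n + 1) → (Fin n → Bool) → Bool,
      (∀ g, HasDegF p (y g) (p - 1)) → ∃ u, ringWinU c y u = false := by
  obtain ⟨J₀, hJ₀⟩ := hS p
  obtain ⟨n₀, hn₀⟩ := noPerfect_of_jlin p hp J₀
  exact ⟨n₀, fun n hn c y hy => hn₀ n hn c y fun g => hJ₀ n (y g) (hy g)⟩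

/-- the θ < 1 Frobenius notch (item 32598) implies the exact one — bookkeeping. -/
theorem noPerfect_of_frobHardOdd (h : Theses.CharDial.FrobHardOdd) (p : ℕ) [Fact p.Prime] (hp : 5 ≤ p) :
    ∃ n₀ : ℕ, ∀ n ≥ n₀, ∀ c : ℕ, ∀ y : Fin (n + 1) → (Fin n → Bool) → Bool,
      (∀ g, HasDegF p (y g) (p - 1)) → ∃ u, ringWinU c y u = false := by
  obtain ⟨θ, hθ, n₀, hn₀⟩ := h p hp
  exact ⟨n₀, fun n hn c y hy => exists_fail_of_card_le c y hθ (hn₀ n hn c y hy)⟩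

end Summit.QuantumAdvantage.QuantumAdvantage.Theorems.PerfectDial
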